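import Literature.Geometry.Lorentzian.GeodesicUniformTime
import Literature.Geometry.Lorentzian.GeodesicExtension
import Literature.Geometry.Lorentzian.GeodesicProofs
import Literature.Analysis.ODE.SmoothDependence
import Literature.Geometry.Riemannian.ExponentialMap
import HarnessLib

/-!
# Continuous dependence of geodesics on their initial data

For a `C¹` covariant derivative `cov` on the tangent bundle of a Hausdorff manifold `M`
(finite-dimensional complete model space), in the framework of
`Literature.Geometry.Lorentzian.Geodesic` (geodesics `γ : ℝ → M` of `cov` on parameter sets,
`tangentLift I γ t = (γ t, γ' t) ∈ TM`), this file proves the **continuous dependence of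
geodesics on the initial point of `TM`** (O'Neill, *Semi-Riemannian geometry* (1983), Ch. 3,
Lemma 22 together with the "standard" theorem on dependence of solutions of ordinary differential
equations on initial conditions quoted before Prop. 28, p. 70; Lee, *Introduction to Riemannian
Manifolds* (2018), Thm. 4.27 (c)–(d) and Prop. 5.19: the geodesic flow is continuous — indeed
smooth — on its open domain):

* `exists_nhds_continuousOn_isGeodesicOn`: every `p₀ ∈ TM` over an interior point has a
  neighbourhood `𝒰` and an `ε > 0` with a family `Γ p` of geodesics on `(-ε, ε)`,
  `tangentLift (Γ p) 0 = p` for `p ∈ 𝒰`, such that `(p, t) ↦ tangentLift (Γ p) t` is continuous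
  on `𝒰 × (-ε, ε)` (the geodesic system in the chart at `π p₀` has a local flow depending
  continuously — in fact `C¹` — on the initial value, `Literature.Analysis.ODE.exists_contDiffOn_flow`,
  and chart solutions are geodesics, `isGeodesicOn_of_chartSolution`);
* for a geodesically complete connection on a manifold without boundary: the tree's
  `maximalGeodesic cov x v` (`ExponentialMap.lean`) is THE entire geodesic `γ_p` with tangent lift
  `p = (x, v)` at `0` (`isGeodesic_maximalGeodesic`, `IsGeodesic.eq_maximalGeodesic`,
  `tangentLift_maximalGeodesic_zero`), its flow property (`maximalGeodesic_tangentLift_eq/_apply`,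
  `tangentLift_maximalGeodesic_add`: `γ_{(γ_p s, γ_p' s)}(t) = γ_p(t + s)`), local joint
  continuity of `(p, t) ↦ (γ_p t, γ_p' t)` (`exists_isOpen_continuousOn_tangentLift_maximalGeodesic`,
  `exists_isOpen_forall_continuousAt_tangentLift_maximalGeodesic`), and — on a compact set of `TM`
  invariant under the geodesic flow — continuity of `p ↦ (γ_p t, γ_p' t)` for ALL `t`
  (`continuousAt_tangentLift_maximalGeodesic_of_isCompact`, by chaining `t = N (t / N)`;
  base-point corollary `continuousAt_maximalGeodesic_of_isCompact`) and JOINT continuity in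
  `(p, t)` at every time there (`continuousAt_uncurry_tangentLift_maximalGeodesic_of_isCompact`,
  `continuousAt_uncurry_maximalGeodesic_of_isCompact`).

Everything is proved; no named facts. The consumer is the compactness step of
Paternain–Salo–Uhlmann 2023, Prop. 3.7.22 (`Literature/Geometry/Riemannian/NonTrappingConvexSublevelProofs.lean`:
geodesic segments of unbounded length in a compact domain accumulate on a trapped geodesic).

## References

* B. O'Neill, *Semi-Riemannian geometry with applications to relativity*, Academic Press 1983,
  Ch. 3, Lemma 22 (p. 68) and the remark before Prop. 28 (p. 70); Ch. 3, Def. 27 ff. (geodesic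
  flow). [ONeill1983]
* J. M. Lee, *Introduction to Riemannian Manifolds*, 2nd ed., GTM 176 (2018), Thm. 4.27,
  Prop. 5.19. [LeeRiemannianManifolds2018]
* S. Lang, *Differential and Riemannian Manifolds*, GTM 160 (1995), Ch. IV §1, Thm. 1.14,
  Thm. 1.16 (dependence on initial conditions). [Lang1995]
-/

noncomputable section

open Bundle Set Filter Metric
open scoped Manifold ContDiff Topology NNReal

namespace Literature.Geometry.Lorentzian

variable {E : Type*} [NormedAddCommGroup E] [NormedSpace ℝ E] {H : Type*} [TopologicalSpace H]
  {I : ModelWithCorners ℝ E H} {M : Type*} [TopologicalSpace M] [ChartedSpace H M]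
  [IsManifold I ∞ M] [FiniteDimensional ℝ E]
  {cov : CovariantDerivative I E (TangentSpace I : M → Type _)}

/-! ### Local continuous dependence -/

/-- **Geodesics depend continuously on their initial data, locally** (O'Neill 1983, Ch. 3,
Lemma 22 with the dependence-on-initial-conditions theorem quoted on p. 70; Lee 2018,
Thm. 4.27 (c),(d)). For a `C¹` connection on a Hausdorff manifold and `p₀ ∈ TM` over an interior
point there are a neighbourhood `𝒰` of `p₀` in `TM`, an `ε > 0` and a family of curves `Γ p`
such that for every `p ∈ 𝒰` the curve `Γ p` is a geodesic of `cov` on `(-ε, ε)` with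
`tangentLift (Γ p) 0 = p`, and `(p, t) ↦ tangentLift (Γ p) t ∈ TM` is continuous on
`𝒰 × (-ε, ε)`. Proof: near `(φ π p₀, (p₀)_φ)` the first-order geodesic system
`(u, w)' = (w, -∑ᵢ wⁱ Ĉᵢ(φ⁻¹ u) w)` in the chart `φ` at `π p₀` is `C¹` (the Christoffel data
`Ĉᵢ` of `exists_christoffelChart` are `C¹` near `π p₀`), so it has a local flow depending
continuously (indeed `C¹`) on the initial value (`Literature.Analysis.ODE.exists_contDiffOn_flow`,
Lang 1995, IV §1, Thm. 1.14); its solutions are geodesics whose tangent lifts read `(u, w)` in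
the trivialisation at `π p₀` (`isGeodesicOn_of_chartSolution`), and the trivialisation is a
homeomorphism onto its image. [cite: ONeill1983, Ch. 3, Lemma 22 and p. 70] -/
theorem exists_nhds_continuousOn_isGeodesicOn [CompleteSpace E] [T2Space M]
    [CovariantDerivative.ContMDiffCovariantDerivative cov 1]
    (p₀ : TangentBundle I M) (hx : I.IsInteriorPoint p₀.proj) :
    ∃ 𝒰 ∈ 𝓝 p₀, ∃ ε > (0 : ℝ), ∃ Γ : TangentBundle I M → ℝ → M,
      (∀ p ∈ 𝒰, IsGeodesicOn cov (Γ p) (Ioo (-ε) ε) ∧ tangentLift I (Γ p) 0 = p) ∧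
      ContinuousOn (fun q : TangentBundle I M × ℝ ↦ tangentLift I (Γ q.1) q.2)
        (𝒰 ×ˢ Ioo (-ε) ε) := by
  set x₁ := p₀.proj with hx₁_def
  set b := Module.finBasis ℝ E with hb_def
  obtain ⟨N, Ĉ, hN, hxN, hNs, hĈ, hĈs⟩ := exists_christoffelChart (cov := cov) b x₁
  set φ := extChartAt I x₁ with hφ_def
  set e₁ := trivializationAt E (TangentSpace I : M → Type _) x₁ with he₁_def
  -- shrink `N` so that the Christoffel data are `C¹` at every point of it
  have hĈn : ∀ i, ∀ᶠ y in 𝓝 x₁, ContMDiffAt I 𝓘(ℝ, E →L[ℝ] E) 1 (Ĉ i) y := fun i ↦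
    (contMDiffAt_iff_contMDiffAt_nhds (by decide)).1 (hĈs i)
  obtain ⟨N₁, hN₁N, hN₁o, hxN₁, hN₁Ĉ⟩ : ∃ N₁ ⊆ N, IsOpen N₁ ∧ x₁ ∈ N₁ ∧
      ∀ y ∈ N₁, ∀ i, ContMDiffAt I 𝓘(ℝ, E →L[ℝ] E) 1 (Ĉ i) y := by
    have h : ∀ᶠ y in 𝓝 x₁, y ∈ N ∧ ∀ i, ContMDiffAt I 𝓘(ℝ, E →L[ℝ] E) 1 (Ĉ i) y :=
      Filter.Eventually.and (hN.mem_nhds hxN) (eventually_all.2 hĈn)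
    obtain ⟨N₁, hN₁, hN₁o, hxN₁⟩ := eventually_nhds_iff.1 h
    exact ⟨N₁, fun y hy ↦ (hN₁ y hy).1, hN₁o, hxN₁, fun y hy ↦ (hN₁ y hy).2⟩
  obtain ⟨O, hO, hxO, hOt, hON, hOr⟩ := exists_chartBall hx hN₁o hxN₁
  -- the first-order system, `C¹` on `O × E`
  set G : E × E → E := fun pq ↦ -∑ i, b.repr pq.2 i • Ĉ i (φ.symm pq.1) pq.2 with hG_def
  set F : E × E → E × E := fun pq ↦ (pq.2, G pq) with hF_def
  have hF : ∀ z ∈ O, ∀ q : E, ContDiffAt ℝ 1 F (z, q) := by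
    intro z hz q
    have hG : ContDiffAt ℝ 1 G (z, q) := by
      have h1 : ∀ i, ContDiffAt ℝ 1 (fun pq : E × E ↦ Ĉ i (φ.symm pq.1)) (z, q) := by
        intro i
        have h2 : ContMDiffWithinAt 𝓘(ℝ, E) 𝓘(ℝ, E →L[ℝ] E) 1 (Ĉ i ∘ φ.symm) (range I) z := by
          refine ContMDiffAt.comp_contMDiffWithinAt _ ?_
            (contMDiffWithinAt_extChartAt_symm_range x₁ (hOt hz))
          exact hN₁Ĉ _ (hON z hz) i
        have h3 : ContDiffAt ℝ 1 (Ĉ i ∘ φ.symm) z :=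
          (contMDiffWithinAt_iff_contDiffWithinAt.mp h2).contDiffAt (hOr z hz)
        exact ContDiffAt.comp (f := Prod.fst) (z, q) h3 contDiffAt_fst
      have h4 : ∀ i, ContDiffAt ℝ 1 (fun pq : E × E ↦ b.repr pq.2 i) (z, q) := fun i ↦
        (((b.coord i).toContinuousLinearMap).contDiff.comp contDiff_snd).contDiffAt
      exact (ContDiffAt.sum fun i _ ↦ (h4 i).smul ((h1 i).clm_apply contDiffAt_snd)).neg
    exact contDiffAt_snd.prodMk hG
  have hU : IsOpen (O ×ˢ (univ : Set E)) := hO.prod isOpen_univ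
  have hFU : ContDiffOn ℝ 1 F (O ×ˢ (univ : Set E)) := fun pq hpq ↦
    (hF pq.1 hpq.1 pq.2).contDiffWithinAt
  -- the local flow around `z₀`, continuous in the initial value
  set z₀ : E × E := (φ x₁, (e₁ p₀).2) with hz₀_def
  have hz₀U : z₀ ∈ O ×ˢ (univ : Set E) := ⟨hxO, mem_univ _⟩
  obtain ⟨fl, r, hr, ε, hε, hfl0, hfld, hflU, hfls⟩ :=
    Literature.Analysis.ODE.exists_contDiffOn_flow (n := 1) hU hFU le_rfl hz₀U
  -- the neighbourhood of `p₀`: points whose chart coordinates lie in the ball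
  set Z : TangentBundle I M → E × E := fun p ↦ (φ p.proj, (e₁ p).2) with hZ_def
  have hp₀ : p₀ ∈ e₁.source := by
    rw [e₁.mem_source, he₁_def, TangentBundle.trivializationAt_baseSet]
    exact mem_chart_source H p₀.proj
  have hZc : ContinuousOn Z e₁.source := by
    refine ContinuousOn.prodMk ?_ ?_
    · refine (continuousOn_extChartAt x₁).comp (FiberBundle.continuous_proj E _).continuousOn ?_
      intro p hp
      rw [extChartAt_source]
      simpa [he₁_def] using e₁.mem_source.1 hp
    · exact continuous_snd.comp_continuousOn e₁.continuousOn
  have hZ₀ : Z p₀ = z₀ := rfl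
  set 𝒰 : Set (TangentBundle I M) := e₁.source ∩ Z ⁻¹' ball z₀ r with h𝒰_def
  have h𝒰o : IsOpen 𝒰 := hZc.isOpen_inter_preimage e₁.open_source isOpen_ball
  have h𝒰 : 𝒰 ∈ 𝓝 p₀ := by
    refine h𝒰o.mem_nhds ⟨hp₀, ?_⟩
    rw [mem_preimage, hZ₀]
    exact mem_ball_self hr
  -- the family of geodesics
  set Γ : TangentBundle I M → ℝ → M := fun p t ↦ φ.symm (fl (Z p) t).1 with hΓ_def
  have hsol : ∀ p ∈ 𝒰, IsGeodesicOn cov (Γ p) (Ioo (-ε) ε) ∧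
      ∀ t ∈ Ioo (-ε) ε, (e₁ (tangentLift I (Γ p) t)).2 = (fl (Z p) t).2 := by
    intro p hp
    have hfd : ∀ t ∈ Ioo (-ε) ε, HasDerivAt (fl (Z p)) (F (fl (Z p) t)) t := fun t ht ↦
      hfld (Z p) hp.2 t ht
    exact isGeodesicOn_of_chartSolution (cov := cov) b (hN₁N.trans hNs |> fun h ↦ h) Ĉ
      (fun y hy i w ↦ hĈ y (hN₁N hy) i w) hO hOt hON hOr isOpen_Ioo hfd
      (fun t ht ↦ (hflU (Z p) hp.2 t ht).1)
  have hproj : ∀ p ∈ 𝒰, p.proj ∈ (chartAt H x₁).source := fun p hp ↦ by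
    simpa [he₁_def] using e₁.mem_source.1 hp.1
  have hlift0 : ∀ p ∈ 𝒰, tangentLift I (Γ p) 0 = p := by
    intro p hp
    have h0 : (0 : ℝ) ∈ Ioo (-ε) ε := ⟨by linarith, hε⟩
    have hf0 : fl (Z p) 0 = Z p := hfl0 (Z p) hp.2
    have hγ0 : Γ p 0 = p.proj := by
      show φ.symm (fl (Z p) 0).1 = p.proj
      rw [hf0]
      exact φ.left_inv (by rw [hφ_def, extChartAt_source]; exact hproj p hp)
    refine eq_of_trivializationAt_snd_eq (x₁ := x₁)
      (by simpa only [tangentLift_proj] using hγ0 ▸ hproj p hp) hγ0 ?_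
    rw [(hsol p hp).2 0 h0, hf0]
  -- the base points stay in the chart domain, the lifts in the source of `e₁`
  have hbase : ∀ p ∈ 𝒰, ∀ t ∈ Ioo (-ε) ε, Γ p t ∈ (chartAt H x₁).source := by
    intro p hp t ht
    rw [← extChartAt_source I]
    exact φ.map_target (hOt (hflU (Z p) hp.2 t ht).1)
  have hsrc : ∀ p ∈ 𝒰, ∀ t ∈ Ioo (-ε) ε, tangentLift I (Γ p) t ∈ e₁.source := by
    intro p hp t ht
    rw [e₁.mem_source, he₁_def, TangentBundle.trivializationAt_baseSet]
    exact hbase p hp t ht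
  have hrepr : ∀ p ∈ 𝒰, ∀ t ∈ Ioo (-ε) ε,
      e₁ (tangentLift I (Γ p) t) = (Γ p t, (fl (Z p) t).2) := by
    intro p hp t ht
    refine Prod.ext ?_ ((hsol p hp).2 t ht)
    rw [e₁.coe_fst (hsrc p hp t ht)]
    rfl
  refine ⟨𝒰, h𝒰, ε, hε, Γ, fun p hp ↦ ⟨(hsol p hp).1, hlift0 p hp⟩, ?_⟩
  -- continuity: `tangentLift (Γ p) t = e₁⁻¹ (φ⁻¹ (fl (Z p) t).1, (fl (Z p) t).2)`
  have hΨ : ContinuousOn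
      (fun q : TangentBundle I M × ℝ ↦ ((φ.symm (fl (Z q.1) q.2).1 : M), (fl (Z q.1) q.2).2))
      (𝒰 ×ˢ Ioo (-ε) ε) := by
    have hflc : ContinuousOn (fun q : TangentBundle I M × ℝ ↦ fl (Z q.1) q.2)
        (𝒰 ×ˢ Ioo (-ε) ε) := by
      have h1 : ContinuousOn (fun q : TangentBundle I M × ℝ ↦ (Z q.1, q.2)) (𝒰 ×ˢ Ioo (-ε) ε) :=
        ((hZc.comp continuous_fst.continuousOn fun q hq ↦ hq.1.1).prodMk
          continuous_snd.continuousOn)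
      refine hfls.continuousOn.comp h1 fun q hq ↦ ⟨hq.1.2, hq.2⟩
    refine ContinuousOn.prodMk ?_ (continuous_snd.comp_continuousOn hflc)
    refine (continuousOn_extChartAt_symm x₁).comp (continuous_fst.comp_continuousOn hflc)
      fun q hq ↦ hOt (hflU (Z q.1) hq.1.2 q.2 hq.2).1
  have hΨt : ∀ q ∈ 𝒰 ×ˢ Ioo (-ε) ε,
      ((φ.symm (fl (Z q.1) q.2).1 : M), (fl (Z q.1) q.2).2) ∈ e₁.target := by
    intro q hq
    rw [e₁.mem_target, he₁_def, TangentBundle.trivializationAt_baseSet]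
    exact hbase q.1 hq.1 q.2 hq.2
  refine (e₁.toPartialHomeomorph.continuousOn_symm.comp hΨ hΨt).congr fun q hq ↦ ?_
  show tangentLift I (Γ q.1) q.2 =
    e₁.toPartialHomeomorph.symm ((φ.symm (fl (Z q.1) q.2).1 : M), (fl (Z q.1) q.2).2)
  rw [← hrepr q.1 hq.1 q.2 hq.2]
  exact (e₁.toPartialHomeomorph.left_inv (hsrc q.1 hq.1 q.2 hq.2)).symm


/-! ### Tangent lifts: extracting position and velocity -/

omit [IsManifold I ∞ M] [FiniteDimensional ℝ E] in
/-- If the tangent lift of `γ` at `t` is `p`, then `γ t` is the base point of `p`. [folklore] -/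
theorem apply_eq_proj_of_tangentLift_eq {γ : ℝ → M} {t : ℝ} {p : TangentBundle I M}
    (h : tangentLift I γ t = p) : γ t = p.proj := by
  subst h
  rfl

omit [IsManifold I ∞ M] [FiniteDimensional ℝ E] in
/-- If the tangent lift of `γ` at `t` is `p`, then `γ' t` is the vector part of `p` (a cross-fibre
equation in `E`). [folklore] -/
theorem velocity_eq_snd_of_tangentLift_eq {γ : ℝ → M} {t : ℝ} {p : TangentBundle I M}
    (h : tangentLift I γ t = p) : velocity I γ t = p.snd := by
  subst h
  rfl

/-! ### Entire geodesics of a complete connection and their flow property -/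

section Complete

open Literature.Geometry.Riemannian

variable [CompleteSpace E] [T2Space M] [BoundarylessManifold I M]
  [CovariantDerivative.ContMDiffCovariantDerivative cov 1]

/-- For a geodesically complete `C¹` connection on a Hausdorff manifold without boundary, the
maximal geodesic `γ_v = maximalGeodesic cov x v` (Lee 2018, p. 126) is a geodesic on all of `ℝ`
with `γ_v 0 = x`, `γ_v' 0 = v`: the entire geodesic through `(x, v)` provided by completeness is
maximal, hence is `γ_v` (`maximalGeodesic_unique`). [cite: LeeRiemannianManifolds2018, Cor. 4.28 and p. 131] -/
theorem isGeodesic_maximalGeodesic (hc : IsGeodesicallyComplete cov) (x : M)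
    (v : TangentSpace I x) :
    IsGeodesic cov (maximalGeodesic cov x v) ∧ maximalGeodesic cov x v 0 = x ∧
      velocity I (maximalGeodesic cov x v) 0 = v := by
  obtain ⟨γ, hγ, hx, hv⟩ := hc x v
  obtain ⟨-, heq⟩ := maximalGeodesic_unique (cov := cov)
    (IsGeodesic.isMaximalGeodesicOn_univ cov hγ) (mem_univ _) hx hv
  have hfun : γ = maximalGeodesic cov x v := funext fun t ↦ heq (mem_univ t)
  rw [← hfun]
  exact ⟨hγ, hx, hv⟩

omit [CompleteSpace E] [T2Space M] [BoundarylessManifold I M]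
  [CovariantDerivative.ContMDiffCovariantDerivative cov 1] in
/-- **Uniqueness of entire geodesics by their tangent lift**: a geodesic on `ℝ` whose tangent
lift at `0` is `p` is the maximal geodesic `γ_p` (O'Neill 1983, Ch. 3, Lemma 22 and p. 68;
`maximalGeodesic_unique`). [cite: ONeill1983, Ch. 3, Lemma 22] -/
theorem IsGeodesic.eq_maximalGeodesic [CompleteSpace E] [T2Space M] [BoundarylessManifold I M]
    [CovariantDerivative.ContMDiffCovariantDerivative cov 1] {γ : ℝ → M} (hγ : IsGeodesic cov γ)
    {p : TangentBundle I M} (h0 : tangentLift I γ 0 = p) :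
    γ = maximalGeodesic cov p.proj p.snd := by
  obtain ⟨-, heq⟩ := maximalGeodesic_unique (cov := cov)
    (IsGeodesic.isMaximalGeodesicOn_univ cov hγ) (mem_univ _) (apply_eq_proj_of_tangentLift_eq h0)
    (velocity_eq_snd_of_tangentLift_eq h0)
  exact funext fun t ↦ heq (mem_univ t)

/-- The tangent lift of `γ_p` at `0` is `p` (complete `C¹` connection).
[cite: LeeRiemannianManifolds2018, p. 126] -/
theorem tangentLift_maximalGeodesic_zero (hc : IsGeodesicallyComplete cov) (p : TangentBundle I M) :
    tangentLift I (maximalGeodesic cov p.proj p.snd) 0 = p := by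
  obtain ⟨-, hx, hv⟩ := isGeodesic_maximalGeodesic hc p.proj p.snd
  exact TotalSpace.ext hx (heq_of_eq hv)

/-- **Flow property of the geodesics of a complete connection** (O'Neill 1983, Ch. 3, Def. 27
ff.: the geodesic flow; Lang 1995, IV §1, Lemma 1.15: the group law of a flow). The maximal
geodesic issuing from the tangent lift of `γ_p` at time `s` is the translate `u ↦ γ_p (u + s)`
(written `γ_p (u - (-s))`): both are entire geodesics with the same tangent lift at `0`.
[cite: ONeill1983, Ch. 3, Lemma 22 and Def. 27 ff.] -/
theorem maximalGeodesic_tangentLift_eq (hc : IsGeodesicallyComplete cov) (p : TangentBundle I M)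
    (s : ℝ) :
    maximalGeodesic cov (tangentLift I (maximalGeodesic cov p.proj p.snd) s).proj
        (tangentLift I (maximalGeodesic cov p.proj p.snd) s).snd =
      fun u ↦ maximalGeodesic cov p.proj p.snd (u - (-s)) := by
  have hγ : IsGeodesic cov (maximalGeodesic cov p.proj p.snd) :=
    (isGeodesic_maximalGeodesic hc _ _).1
  have h1 : IsGeodesic cov fun u ↦ maximalGeodesic cov p.proj p.snd (u - (-s)) := by
    have h := IsGeodesicOn.comp_sub_const hγ (-s)
    rwa [preimage_univ] at h
  have h2 : tangentLift I (fun u ↦ maximalGeodesic cov p.proj p.snd (u - (-s))) 0 =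
      tangentLift I (maximalGeodesic cov p.proj p.snd) s := by
    rw [tangentLift_comp_sub_const, zero_sub, neg_neg]
  exact (h1.eq_maximalGeodesic h2).symm

/-- Flow property, pointwise: `γ_{(γ_p s, γ_p' s)}(t) = γ_p (t + s)`.
[cite: ONeill1983, Ch. 3, Lemma 22 and Def. 27 ff.] -/
theorem maximalGeodesic_tangentLift_apply (hc : IsGeodesicallyComplete cov)
    (p : TangentBundle I M) (s t : ℝ) :
    maximalGeodesic cov (tangentLift I (maximalGeodesic cov p.proj p.snd) s).proj
        (tangentLift I (maximalGeodesic cov p.proj p.snd) s).snd t =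
      maximalGeodesic cov p.proj p.snd (t + s) := by
  rw [maximalGeodesic_tangentLift_eq hc p s]
  simp only [sub_neg_eq_add]

/-- Flow property for tangent lifts: `Φ_{t+s} = Φ_t ∘ Φ_s` for
`Φ_t p = (γ_p t, γ_p' t)`. [cite: ONeill1983, Ch. 3, Lemma 22 and Def. 27 ff.] -/
theorem tangentLift_maximalGeodesic_add (hc : IsGeodesicallyComplete cov) (p : TangentBundle I M)
    (s t : ℝ) :
    tangentLift I (maximalGeodesic cov p.proj p.snd) (t + s) =
      tangentLift I (maximalGeodesic cov (tangentLift I (maximalGeodesic cov p.proj p.snd) s).proj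
        (tangentLift I (maximalGeodesic cov p.proj p.snd) s).snd) t := by
  rw [maximalGeodesic_tangentLift_eq hc p s, tangentLift_comp_sub_const, sub_neg_eq_add]

/-! ### Continuity of the geodesic flow -/

/-- **Local continuity of the geodesic flow of a complete connection**: every `p₀ ∈ TM` has an
open neighbourhood `𝒰` and an `ε > 0` such that `(q, t) ↦ (γ_q t, γ_q' t)` is continuous on
`𝒰 × (-ε, ε)` (`exists_nhds_continuousOn_isGeodesicOn` and uniqueness of geodesics: the local
family `Γ q` agrees with `γ_q` on `(-ε, ε)`). O'Neill 1983, Ch. 3, p. 70; Lee 2018,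
Thm. 4.27 (d) / Prop. 5.19. [cite: ONeill1983, Ch. 3, Lemma 22 and p. 70] -/
theorem exists_isOpen_continuousOn_tangentLift_maximalGeodesic (hc : IsGeodesicallyComplete cov)
    (p₀ : TangentBundle I M) :
    ∃ 𝒰 : Set (TangentBundle I M), IsOpen 𝒰 ∧ p₀ ∈ 𝒰 ∧ ∃ ε > (0 : ℝ),
      ContinuousOn (fun q : TangentBundle I M × ℝ ↦
        tangentLift I (maximalGeodesic cov q.1.proj q.1.snd) q.2) (𝒰 ×ˢ Ioo (-ε) ε) := by
  obtain ⟨𝒰, h𝒰, ε, hε, Γ, hΓ, hcont⟩ :=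
    exists_nhds_continuousOn_isGeodesicOn (cov := cov) p₀ BoundarylessManifold.isInteriorPoint
  refine ⟨interior 𝒰, isOpen_interior, mem_interior_iff_mem_nhds.2 h𝒰, ε, hε, ?_⟩
  refine (hcont.mono (prod_mono interior_subset Subset.rfl)).congr fun q hq ↦ ?_
  obtain ⟨hgeo, h0⟩ := hΓ q.1 (interior_subset hq.1)
  obtain ⟨hmax, hx, hv⟩ := isGeodesic_maximalGeodesic hc q.1.proj q.1.snd
  have heqOn : EqOn (maximalGeodesic cov q.1.proj q.1.snd) (Γ q.1) (Ioo (-ε) ε) :=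
    IsGeodesicOn.eqOn_of_velocity_eq_holds isOpen_Ioo Set.ordConnected_Ioo (hmax.isGeodesicOn _)
      hgeo (t₀ := 0) ⟨by linarith, hε⟩ (hx.trans (apply_eq_proj_of_tangentLift_eq h0).symm)
      (hv.trans (velocity_eq_snd_of_tangentLift_eq h0).symm)
  exact tangentLift_congr_of_eventuallyEq
    (Filter.eventuallyEq_of_mem (isOpen_Ioo.mem_nhds hq.2) heqOn)

/-- For small times the time-`t` map `q ↦ (γ_q t, γ_q' t)` of the geodesic flow is continuous
at every point of a neighbourhood of `p₀`, with a locally uniform time.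
[cite: ONeill1983, Ch. 3, Lemma 22 and p. 70] -/
theorem exists_isOpen_forall_continuousAt_tangentLift_maximalGeodesic
    (hc : IsGeodesicallyComplete cov) (p₀ : TangentBundle I M) :
    ∃ 𝒰 : Set (TangentBundle I M), IsOpen 𝒰 ∧ p₀ ∈ 𝒰 ∧ ∃ ε > (0 : ℝ), ∀ t ∈ Ioo (-ε) ε,
      ∀ q ∈ 𝒰, ContinuousAt (fun q' : TangentBundle I M ↦
        tangentLift I (maximalGeodesic cov q'.proj q'.snd) t) q := by
  obtain ⟨𝒰, h𝒰o, hp₀, ε, hε, hcont⟩ := exists_isOpen_continuousOn_tangentLift_maximalGeodesic hc p₀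
  refine ⟨𝒰, h𝒰o, hp₀, ε, hε, fun t ht q hq ↦ ?_⟩
  have h1 : ContinuousAt (fun q' : TangentBundle I M × ℝ ↦
      tangentLift I (maximalGeodesic cov q'.1.proj q'.1.snd) q'.2) (q, t) :=
    hcont.continuousAt ((h𝒰o.prod isOpen_Ioo).mem_nhds ⟨hq, ht⟩)
  have h2 : ContinuousAt (fun q' : TangentBundle I M ↦ ((q', t) : TangentBundle I M × ℝ)) q :=
    (continuous_id.prodMk continuous_const).continuousAt
  exact ContinuousAt.comp (f := fun q' : TangentBundle I M ↦ ((q', t) : TangentBundle I M × ℝ))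
    (g := fun q' : TangentBundle I M × ℝ ↦
      tangentLift I (maximalGeodesic cov q'.1.proj q'.1.snd) q'.2) h1 h2

/-- **Continuity of the geodesic flow for all times on a compact invariant set** (O'Neill 1983,
Ch. 3, Def. 27 ff.; Lee 2018, Thm. 4.27 (d): the flow is continuous on its domain — here the
part needed on compact invariant sets, e.g. sphere bundles of a compact Riemannian manifold).
Let `cov` be a complete `C¹` connection and `K ⊆ TM` a compact set invariant under the geodesic
flow (`(γ_p t, γ_p' t) ∈ K` for `p ∈ K` and all `t`). Then for every `t` the map
`q ↦ (γ_q t, γ_q' t)` is continuous at every point of `K`. Proof: by compactness there is a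
uniform `ε₀ > 0` such that the time-`u` maps, `|u| < ε₀`, are continuous at all points of `K`;
write `t = N s` with `|s| < ε₀` and use the flow property `Φ_{(k+1)s} = Φ_{ks} ∘ Φ_s` and
invariance inductively. [cite: ONeill1983, Ch. 3, Lemma 22, p. 70 and Def. 27 ff.] -/
theorem continuousAt_tangentLift_maximalGeodesic_of_isCompact (hc : IsGeodesicallyComplete cov)
    {K : Set (TangentBundle I M)} (hK : IsCompact K)
    (hinv : ∀ p ∈ K, ∀ t : ℝ, tangentLift I (maximalGeodesic cov p.proj p.snd) t ∈ K) (t : ℝ)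
    {p : TangentBundle I M} (hp : p ∈ K) :
    ContinuousAt (fun q : TangentBundle I M ↦ tangentLift I (maximalGeodesic cov q.proj q.snd) t)
      p := by
  classical
  -- a uniform small time on `K`
  obtain ⟨ε₀, hε₀, hunif⟩ : ∃ ε₀ > (0 : ℝ), ∀ u ∈ Ioo (-ε₀) ε₀, ∀ q ∈ K,
      ContinuousAt (fun q' : TangentBundle I M ↦
        tangentLift I (maximalGeodesic cov q'.proj q'.snd) u) q := by
    choose 𝒰 h𝒰o hmem ε hε hcont using
      fun p₀ : TangentBundle I M ↦ exists_isOpen_forall_continuousAt_tangentLift_maximalGeodesic hc p₀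
    obtain ⟨T, -, hT⟩ := hK.elim_nhds_subcover 𝒰 fun q _ ↦ (h𝒰o q).mem_nhds (hmem q)
    have hTne : T.Nonempty := by
      by_contra h
      rw [Finset.not_nonempty_iff_eq_empty] at h
      have := hT hp
      simp [h] at this
    refine ⟨T.inf' hTne ε, (Finset.lt_inf'_iff hTne).2 fun q _ ↦ hε q, fun u hu q hq ↦ ?_⟩
    obtain ⟨q₀, hq₀, hqq₀⟩ := mem_iUnion₂.1 (hT hq)
    refine hcont q₀ u ⟨?_, ?_⟩ q hqq₀
    · exact lt_of_le_of_lt (neg_le_neg (Finset.inf'_le ε hq₀)) hu.1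
    · exact lt_of_lt_of_le hu.2 (Finset.inf'_le ε hq₀)
  -- `t = N s` with `|s| < ε₀`
  obtain ⟨N, hN⟩ : ∃ N : ℕ, |t| / ε₀ < N := exists_nat_gt _
  have hNpos : (0 : ℝ) < N := lt_of_le_of_lt (div_nonneg (abs_nonneg t) hε₀.le) hN
  have hN0 : (N : ℝ) ≠ 0 := hNpos.ne'
  set s : ℝ := t / N with hs_def
  have hs : s ∈ Ioo (-ε₀) ε₀ := by
    have h1 : |t| < N * ε₀ := by
      have := (div_lt_iff₀ hε₀).1 hN
      linarith
    have h2 : |s| < ε₀ := by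
      rw [hs_def, abs_div, abs_of_pos hNpos, div_lt_iff₀ hNpos]
      linarith
    exact ⟨by linarith [neg_abs_le s, h2], lt_of_le_of_lt (le_abs_self s) h2⟩
  -- induction on the number of steps
  have hstep : ∀ k : ℕ, ∀ q ∈ K, ContinuousAt (fun q' : TangentBundle I M ↦
      tangentLift I (maximalGeodesic cov q'.proj q'.snd) (k * s)) q := by
    intro k
    induction k with
    | zero =>
      intro q hq
      have h0 : ((0 : ℕ) : ℝ) * s ∈ Ioo (-ε₀) ε₀ := by
        simp only [Nat.cast_zero, zero_mul]
        exact ⟨by linarith, hε₀⟩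
      exact hunif _ h0 q hq
    | succ k ih =>
      intro q hq
      have hfun : (fun q' : TangentBundle I M ↦
          tangentLift I (maximalGeodesic cov q'.proj q'.snd) ((k + 1 : ℕ) * s)) =
          (fun q' : TangentBundle I M ↦
            tangentLift I (maximalGeodesic cov q'.proj q'.snd) (k * s)) ∘
          fun q' : TangentBundle I M ↦ tangentLift I (maximalGeodesic cov q'.proj q'.snd) s := by
        funext q'
        simp only [Function.comp_apply, Nat.cast_succ, add_mul, one_mul]
        exact tangentLift_maximalGeodesic_add hc q' s (k * s)
      rw [hfun]
      exact ContinuousAt.comp (ih _ (hinv q hq s)) (hunif s hs q hq)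
  have ht : t = N * s := by
    rw [hs_def, mul_div_cancel₀ t hN0]
  rw [ht]
  exact hstep N p hp

/-- Base-point form of `continuousAt_tangentLift_maximalGeodesic_of_isCompact`: on a compact
set of `TM` invariant under the geodesic flow of a complete `C¹` connection, `q ↦ γ_q t` is
continuous at every point of the set, for every `t`. [cite: ONeill1983, Ch. 3, Lemma 22, p. 70 and Def. 27 ff.] -/
theorem continuousAt_maximalGeodesic_of_isCompact (hc : IsGeodesicallyComplete cov)
    {K : Set (TangentBundle I M)} (hK : IsCompact K)
    (hinv : ∀ p ∈ K, ∀ t : ℝ, tangentLift I (maximalGeodesic cov p.proj p.snd) t ∈ K) (t : ℝ)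
    {p : TangentBundle I M} (hp : p ∈ K) :
    ContinuousAt (fun q : TangentBundle I M ↦ maximalGeodesic cov q.proj q.snd t) p :=
  (FiberBundle.continuous_proj E (TangentSpace I : M → Type _)).continuousAt.comp
    (continuousAt_tangentLift_maximalGeodesic_of_isCompact hc hK hinv t hp)


/-! ### Joint continuity in the initial vector and the time -/

/-- **Joint continuity of the geodesic flow `(q, t) ↦ (γ_q t, γ_q' t)` on a compact invariant
set, at every time** (O'Neill 1983, Ch. 3, Def. 27 ff.; Lee 2018, Thm. 4.27 (d): the flow is
continuous — indeed smooth — jointly on its domain). For a complete `C¹` connection, a compact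
flow-invariant `K ⊆ TM`, `p ∈ K` and any `t`, the map is continuous at `(p, t)`: write
`Φ(q, t') = Φ_{t' - t}(Φ_t q)` (flow property); `q ↦ Φ_t q` is continuous at `p`
(`continuousAt_tangentLift_maximalGeodesic_of_isCompact`) and `(q', s) ↦ Φ_s q'` is jointly
continuous near `(Φ_t p, 0)` (`exists_isOpen_continuousOn_tangentLift_maximalGeodesic`).
[cite: ONeill1983, Ch. 3, Lemma 22, p. 70 and Def. 27 ff.] -/
theorem continuousAt_uncurry_tangentLift_maximalGeodesic_of_isCompact
    (hc : IsGeodesicallyComplete cov) {K : Set (TangentBundle I M)} (hK : IsCompact K)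
    (hinv : ∀ p ∈ K, ∀ t : ℝ, tangentLift I (maximalGeodesic cov p.proj p.snd) t ∈ K) (t : ℝ)
    {p : TangentBundle I M} (hp : p ∈ K) :
    ContinuousAt (fun qt : TangentBundle I M × ℝ ↦
      tangentLift I (maximalGeodesic cov qt.1.proj qt.1.snd) qt.2) (p, t) := by
  set p₁ : TangentBundle I M := tangentLift I (maximalGeodesic cov p.proj p.snd) t with hp₁_def
  obtain ⟨𝒰, h𝒰o, hp₁𝒰, ε, hε, hcont⟩ :=
    exists_isOpen_continuousOn_tangentLift_maximalGeodesic hc p₁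
  -- `Φ(q, t') = Φ_{t' - t} (Φ_t q)`
  have hflow : (fun qt : TangentBundle I M × ℝ ↦
      tangentLift I (maximalGeodesic cov qt.1.proj qt.1.snd) qt.2) =
      (fun q's : TangentBundle I M × ℝ ↦
        tangentLift I (maximalGeodesic cov q's.1.proj q's.1.snd) q's.2) ∘
      fun qt : TangentBundle I M × ℝ ↦
        (tangentLift I (maximalGeodesic cov qt.1.proj qt.1.snd) t, qt.2 - t) := by
    funext qt
    simp only [Function.comp_apply]
    have h := tangentLift_maximalGeodesic_add hc qt.1 t (qt.2 - t)
    rwa [sub_add_cancel] at h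
  rw [hflow]
  refine ContinuousAt.comp ?_ ?_
  · have h0 : (tangentLift I (maximalGeodesic cov p.proj p.snd) t, t - t) ∈ 𝒰 ×ˢ Ioo (-ε) ε := by
      rw [sub_self]
      exact ⟨hp₁𝒰, by simpa using hε⟩
    exact hcont.continuousAt ((h𝒰o.prod isOpen_Ioo).mem_nhds h0)
  · exact (ContinuousAt.comp_of_eq
      (continuousAt_tangentLift_maximalGeodesic_of_isCompact hc hK hinv t hp)
      continuousAt_fst rfl).prodMk ((continuous_snd.sub continuous_const).continuousAt)

/-- Base-point form: on a compact flow-invariant set of a complete `C¹` connection,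
`(q, t) ↦ γ_q t` is jointly continuous at `(p, t)` for `p` in the set and every `t`.
[cite: ONeill1983, Ch. 3, Lemma 22, p. 70 and Def. 27 ff.] -/
theorem continuousAt_uncurry_maximalGeodesic_of_isCompact (hc : IsGeodesicallyComplete cov)
    {K : Set (TangentBundle I M)} (hK : IsCompact K)
    (hinv : ∀ p ∈ K, ∀ t : ℝ, tangentLift I (maximalGeodesic cov p.proj p.snd) t ∈ K) (t : ℝ)
    {p : TangentBundle I M} (hp : p ∈ K) :
    ContinuousAt (fun qt : TangentBundle I M × ℝ ↦ maximalGeodesic cov qt.1.proj qt.1.snd qt.2)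
      (p, t) :=
  (FiberBundle.continuous_proj E (TangentSpace I : M → Type _)).continuousAt.comp
    (continuousAt_uncurry_tangentLift_maximalGeodesic_of_isCompact hc hK hinv t hp)
end Complete

end Literature.Geometry.Lorentzian

end
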